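import Literature.Probability.RandomPlanarGeometry.HexSAWStripBetaSeriesWidthTwoXY
import Literature.Probability.RandomPlanarGeometry.HexSAWStripBetaLengthWidthOne
import Literature.Probability.RandomPlanarGeometry.HexSAWStripSurfaceThresholdUnique
import Mathlib.Analysis.MeanInequalities
import HarnessLib

/-!
# The three phases of the β-walks of the strip counted by LENGTH: exponential decay below `y_T`, the constant `Λℓ_T` at `y_T`,
# exponential blow-up above `y_T` (module «BETA-LENGTH-PHASES»)

Topic `Literature/Probability/RandomPlanarGeometry` (continues «BETA-SERIES-WIDTH-TWO-XY» (`HV.betaCount T n y = Σ_{β-walks with n vertices} y^{#top}`,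
`HV.betaLenSum_eq_pow_mul_betaCount`), «BETA-LENGTH-WIDTH-ONE» (`HV.exists_pos_tendsto_betaLenSum_even_of_one_le`: `bℓ_T(2m)(y_T) → Λℓ_T > 0`, every
`T ≥ 1`), «BETA-NORENEWAL» #483 (`HV.exists_pow_mul_stripZL_le_geometric`: `x_c^n Z_{T,n}(y) ≤ Cθⁿ` when `x_c ν_T(y) < 1`), `HexSAWStripSurfaceThresholdUnique.lean`
(`HV.stripNu_lt_inv_of_lt_stripYT`: `ν_T(y) < x_c⁻¹` for `y < y_T`), `HexSAWStripSurfaceGrowthLogConvex.lean` (`HV.stripZL_interp_le`: Hölder for the chain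
partition functions — the template of §3)).  Lane «pcv-sawmu», a-p2 g22 — car 9 of the «β-walks by length» programme.  Sources of the SETTING: N. R. Beaton
et al., CMP 326 (2014) §3.2 (Proposition 6: `μ_T(1,y)`, its log-convexity in `log y`), Corollary 8 (arXiv:1109.0358v5 p. 12: `ρ_T(y_T) = x_c`, `y_T` the radius
of `B_T(x_c; ·)`); H. Duminil-Copin, S. Smirnov, Ann. Math. 175 (2012) §3.  The phase statements are the lane's.

## What is proved (namespace `Literature.Probability.RandomPlanarGeometry.SAW.HV`; `bℓ_T(n)(y) = HV.betaLenSum T n y = x_c^n·betaCount T n y`, `T ≥ 1`)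

* §1 `betaLen_subset_stripChains` (a β-walk with `n ≥ 1` vertices is an `(n−1)`-step chain of `S_T`), `betaCount_le_stripZL`, `betaLenSum_zero_len`.
* §2 ★★ SUBCRITICAL `0 < y < y_T`: `exists_betaLenSum_le_geometric` — `bℓ_T(n)(y) ≤ C θⁿ` with `θ < 1`; `tendsto_betaLenSum_of_lt_stripYT` (`→ 0`).
* §3 `betaCount_interp_le` — Hölder: `betaCount T n (y₁^θ y₂^{1−θ}) ≤ betaCount T n y₁ ^ θ · betaCount T n y₂ ^ (1−θ)` (log-convexity in `log y` of each
  length slice), and the same for `betaLenSum` (`betaLenSum_interp_le`).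
* §5 ★★ `hasSum_betaLenSum_of_lt_stripYT` — for `0 ≤ y < y_T`, `Σ_n bℓ_T(n)(y) = B_T(x_c; y) = HV.stripByLim T y` (`HasSum`, every `T ≥ 1`): the length
  decomposition of the tree's β-series below its radius (the tree's `HV.stripGFy_beta_eq_sum_bridgeLists`, `sum_range_betaLenSum_le_stripGFy`, `stripGFy_le_sum_range_betaLenSum`).
* §4 ★★★ SUPERCRITICAL `y > y_T`: `tendsto_betaLenSum_atTop_of_stripYT_lt` — `bℓ_T(2m)(y) → ∞` (`m → ∞`): interpolate `y_T = 1^θ · y^{1−θ}` between the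
  subcritical point `1` (geometric decay) and `y`; since `bℓ_T(2m)(y_T) → Λℓ_T > 0` the slice at `y` must blow up (indeed exponentially).
  With «WIDTH-ONE»'s critical law this is the complete phase diagram of the `x_c`-weighted length slices: `→ 0` exponentially / `→ Λℓ_T ∈ (0,∞)` / `→ ∞`.

Label: LANE THEOREM (own, a-p2 g22, 2026-08-26).  NOT claimed: the exponential RATE above `y_T` as a named constant, odd lengths (empty), uniformity in `T`.
-/

noncomputable section

open Finset Filter Topology Literature.Probability.LatticeModels Literature.Probability.Percolation

namespace Literature.Probability.RandomPlanarGeometry.SAW.HV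

variable {T : ℕ} {y : ℝ}

/-! ### §1 β-walks of length `n` are chains with `n − 1` steps -/

/-- A β-walk of `S_T` with `n ≥ 1` vertices is an `(n − 1)`-step self-avoiding chain of `S_T` with standard head (`HV.stripChains`).
[cite: DuminilCopinSmirnov2012, §3; MadrasSlade1993, §8.2 eq. (8.2.1); lane plumbing] -/
theorem betaLen_subset_stripChains (hT : 1 ≤ T) {n : ℕ} (hn : 1 ≤ n) : betaLen T n n ⊆ stripChains T (n - 1) := by
  intro l hl
  rw [betaLen, mem_filter] at hl
  obtain ⟨hc, hh, hnd, hV, -, -⟩ := (mem_bridgeLists_iff hT).1 hl.1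
  rw [mem_stripChains_iff]
  exact ⟨hc, hnd, by omega, ⟨hvOrigin, hh, rfl⟩, inLev_of_subset hV (fun _ h => h)⟩

/-- `betaCount T n y ≤ Z_{T,n−1}(y)` for `n ≥ 1`, `y ≥ 0`. [cite: BeatonBousquetMelouDeGierDuminilCopinGuttmann2014, §3.2 (Proposition 6: the partition functions c_{T,k}); lane plumbing] -/
theorem betaCount_le_stripZL (hT : 1 ≤ T) (hy : 0 ≤ y) {n : ℕ} (hn : 1 ≤ n) : betaCount T n y ≤ stripZL T (n - 1) y := by
  rw [betaCount, stripZL]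
  exact sum_le_sum_of_subset_of_nonneg (betaLen_subset_stripChains hT hn) fun _ _ _ => pow_nonneg hy _

/-- No β-walk has `0` vertices: `bℓ_T(0)(y) = 0` and `betaCount T 0 y = 0` (`T ≥ 1`). [cite: DuminilCopinSmirnov2012, §3; lane plumbing] -/
theorem betaLenSum_zero_len (hT : 1 ≤ T) (y : ℝ) : betaLenSum T 0 y = 0 ∧ betaCount T 0 y = 0 := by
  have hempty : betaLen T 0 0 = ∅ := by
    rw [betaLen, Finset.filter_eq_empty_iff]
    intro l hl h0
    obtain ⟨-, -, -, -, hne, -⟩ := (mem_bridgeLists_iff hT).1 hl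
    exact hne (List.eq_nil_of_length_eq_zero h0)
  simp [betaLenSum, betaCount, hempty]

/-! ### §2 Below the threshold the length slices decay geometrically -/

/-- ★★ **SUBCRITICAL PHASE**: for `0 < y < y_T` there are `C ≥ 0` and `θ ∈ (0,1)` with `bℓ_T(n)(y) ≤ C · θⁿ` for every `n` (`T ≥ 1`) — the `x_c`-weighted
β-walks of each length decay exponentially (through `ν_T(y) < x_c⁻¹` below `y_T` and the chain bound `x_c^n Z_{T,n}(y) ≤ C θⁿ`).
[cite: BeatonBousquetMelouDeGierDuminilCopinGuttmann2014, Corollary 8 (arXiv v5 p. 12: ρ_T(y) > x_c for y < y_T); lane «pcv-sawmu» a-p2 g22 — own] -/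
theorem exists_betaLenSum_le_geometric (hT : 1 ≤ T) (hy : 0 < y) (hlt : y < stripYT T) :
    ∃ C θ : ℝ, 0 < θ ∧ θ < 1 ∧ 0 ≤ C ∧ ∀ n : ℕ, betaLenSum T n y ≤ C * θ ^ n := by
  have hx := hexCriticalFugacity_pos_lt_one
  have hν : hexCriticalFugacity * stripNu T y < 1 := by
    have h := stripNu_lt_inv_of_lt_stripYT hT hy hlt
    calc hexCriticalFugacity * stripNu T y < hexCriticalFugacity * hexCriticalFugacity⁻¹ := mul_lt_mul_of_pos_left h hx.1
      _ = 1 := mul_inv_cancel₀ hx.1.ne'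
  obtain ⟨C, θ, hθ0, hθ1, hC0, hb⟩ := exists_pow_mul_stripZL_le_geometric hT hy hν
  have hC' : 0 ≤ hexCriticalFugacity * C / θ := div_nonneg (mul_nonneg hx.1.le hC0) hθ0.le
  refine ⟨hexCriticalFugacity * C / θ, θ, hθ0, hθ1, hC', fun n => ?_⟩
  rcases Nat.eq_zero_or_pos n with rfl | hn
  · rw [(betaLenSum_zero_len hT y).1]; exact mul_nonneg hC' (pow_nonneg hθ0.le _)
  · rw [betaLenSum_eq_pow_mul_betaCount]
    have h1 := betaCount_le_stripZL hT hy.le (n := n) hn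
    have h2 := hb (n - 1)
    calc hexCriticalFugacity ^ n * betaCount T n y ≤ hexCriticalFugacity ^ n * stripZL T (n - 1) y :=
          mul_le_mul_of_nonneg_left h1 (pow_nonneg hx.1.le _)
      _ = hexCriticalFugacity * (hexCriticalFugacity ^ (n - 1) * stripZL T (n - 1) y) := by
          rw [← mul_assoc, ← pow_succ']; congr 2; omega
      _ ≤ hexCriticalFugacity * (C * θ ^ (n - 1)) := mul_le_mul_of_nonneg_left h2 hx.1.le
      _ = hexCriticalFugacity * C / θ * θ ^ n := by
          rw [show θ ^ n = θ ^ (n - 1) * θ by rw [← pow_succ]; congr 1; omega]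
          field_simp

/-- `bℓ_T(n)(y) → 0` for `0 < y < y_T` (`T ≥ 1`). [cite: BeatonBousquetMelouDeGierDuminilCopinGuttmann2014, Corollary 8; lane «pcv-sawmu» a-p2 g22 — own] -/
theorem tendsto_betaLenSum_of_lt_stripYT (hT : 1 ≤ T) (hy : 0 < y) (hlt : y < stripYT T) :
    Tendsto (fun n : ℕ => betaLenSum T n y) atTop (𝓝 0) := by
  obtain ⟨C, θ, hθ0, hθ1, hC0, hb⟩ := exists_betaLenSum_le_geometric hT hy hlt
  have hg : Tendsto (fun n : ℕ => C * θ ^ n) atTop (𝓝 0) := by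
    simpa using (tendsto_pow_atTop_nhds_zero_of_lt_one hθ0.le hθ1).const_mul C
  exact squeeze_zero (fun n => (betaLenSum_noRenLen_nonneg hy.le n).1) hb hg

/-! ### §3 Each length slice is log-convex in `log y` (Hölder) -/

/-- `(y₁^θ y₂^{1−θ})^c = (y₁^c)^θ (y₂^c)^{1−θ}` (plumbing). [folklore] (`private` — a statement-twin of the private helper of `HexSAWStripSurfaceGrowthLogConvex.lean`.) -/
private theorem pow_interp_eq' {y₁ y₂ : ℝ} (hy₁ : 0 ≤ y₁) (hy₂ : 0 ≤ y₂) (θ : ℝ) (c : ℕ) :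
    (y₁ ^ θ * y₂ ^ (1 - θ)) ^ c = (y₁ ^ c) ^ θ * (y₂ ^ c) ^ (1 - θ) := by
  rw [mul_pow, ← Real.rpow_natCast (y₁ ^ θ), ← Real.rpow_natCast (y₂ ^ (1 - θ)), ← Real.rpow_mul hy₁, ← Real.rpow_mul hy₂,
    mul_comm θ, mul_comm (1 - θ), Real.rpow_mul hy₁, Real.rpow_mul hy₂, Real.rpow_natCast, Real.rpow_natCast]

/-- **Hölder on a length slice**: `betaCount T n (y₁^θ y₂^{1−θ}) ≤ (betaCount T n y₁)^θ · (betaCount T n y₂)^{1−θ}` (`y₁, y₂ > 0`, `0 ≤ θ ≤ 1`) — each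
`betaCount T n` is a sum of powers `y^{c(ω)}`, hence log-convex in `log y`. [cite: BeatonBousquetMelouDeGierDuminilCopinGuttmann2014, Proposition 6 (arXiv v5 p. 10: log-convexity in log y; proof p. 11); lane «pcv-sawmu» a-p2 g22] -/
theorem betaCount_interp_le (T n : ℕ) {y₁ y₂ : ℝ} (hy₁ : 0 < y₁) (hy₂ : 0 < y₂) {θ : ℝ} (hθ₀ : 0 ≤ θ) (hθ₁ : θ ≤ 1) :
    betaCount T n (y₁ ^ θ * y₂ ^ (1 - θ)) ≤ betaCount T n y₁ ^ θ * betaCount T n y₂ ^ (1 - θ) := by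
  rcases hθ₀.eq_or_lt with rfl | hθ₀'
  · simp
  rcases hθ₁.eq_or_lt with rfl | hθ₁'
  · simp
  have hpq : θ⁻¹.HolderConjugate (1 - θ)⁻¹ := Real.HolderConjugate.inv_one_sub_inv hθ₀' hθ₁'
  have h := Real.inner_le_Lp_mul_Lq_of_nonneg (betaLen T n n) hpq
    (f := fun l => (y₁ ^ topCnt T l) ^ θ) (g := fun l => (y₂ ^ topCnt T l) ^ (1 - θ))
    (fun l _ => Real.rpow_nonneg (pow_nonneg hy₁.le _) _) (fun l _ => Real.rpow_nonneg (pow_nonneg hy₂.le _) _)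
  have hθne : θ ≠ 0 := hθ₀'.ne'
  have h1θne : 1 - θ ≠ 0 := (sub_pos.2 hθ₁').ne'
  simp only [one_div, inv_inv] at h
  unfold betaCount
  simp_rw [pow_interp_eq' hy₁.le hy₂.le θ]
  refine h.trans_eq ?_
  congr 2
  · exact sum_congr rfl fun l _ => Real.rpow_rpow_inv (pow_nonneg hy₁.le _) hθne
  · exact sum_congr rfl fun l _ => Real.rpow_rpow_inv (pow_nonneg hy₂.le _) h1θne

/-- The same for the `x_c`-weighted slices: `bℓ_T(n)(y₁^θ y₂^{1−θ}) ≤ bℓ_T(n)(y₁)^θ · bℓ_T(n)(y₂)^{1−θ}`. [cite: BeatonBousquetMelouDeGierDuminilCopinGuttmann2014, Proposition 6; lane «pcv-sawmu» a-p2 g22] -/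
theorem betaLenSum_interp_le (T n : ℕ) {y₁ y₂ : ℝ} (hy₁ : 0 < y₁) (hy₂ : 0 < y₂) {θ : ℝ} (hθ₀ : 0 ≤ θ) (hθ₁ : θ ≤ 1) :
    betaLenSum T n (y₁ ^ θ * y₂ ^ (1 - θ)) ≤ betaLenSum T n y₁ ^ θ * betaLenSum T n y₂ ^ (1 - θ) := by
  have hx := hexCriticalFugacity_pos_lt_one
  have hxn : 0 ≤ hexCriticalFugacity ^ n := pow_nonneg hx.1.le _
  rw [betaLenSum_eq_pow_mul_betaCount, betaLenSum_eq_pow_mul_betaCount, betaLenSum_eq_pow_mul_betaCount,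
    Real.mul_rpow hxn (betaCount_nonneg hy₁.le T n), Real.mul_rpow hxn (betaCount_nonneg hy₂.le T n)]
  have hsplit : hexCriticalFugacity ^ n = (hexCriticalFugacity ^ n) ^ θ * (hexCriticalFugacity ^ n) ^ (1 - θ) := by
    rw [← Real.rpow_add (pow_pos hx.1 n), add_sub_cancel, Real.rpow_one]
  calc hexCriticalFugacity ^ n * betaCount T n (y₁ ^ θ * y₂ ^ (1 - θ))
      ≤ hexCriticalFugacity ^ n * (betaCount T n y₁ ^ θ * betaCount T n y₂ ^ (1 - θ)) :=
        mul_le_mul_of_nonneg_left (betaCount_interp_le T n hy₁ hy₂ hθ₀ hθ₁) hxn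
    _ = (hexCriticalFugacity ^ n) ^ θ * betaCount T n y₁ ^ θ * ((hexCriticalFugacity ^ n) ^ (1 - θ) * betaCount T n y₂ ^ (1 - θ)) := by
        conv_lhs => rw [hsplit]
        ring

/-! ### §4 Above the threshold the even length slices blow up -/

/-- ★★★ **SUPERCRITICAL PHASE**: for `y > y_T`, `bℓ_T(2m)(y) = Σ_{β-walks with 2m vertices} x_c^{2m} y^{#top} → ∞` (`T ≥ 1`).  Interpolate
`y_T = 1^θ · y^{1−θ}` (`θ = 1 − log y_T/log y ∈ (0,1)`): by §3, `bℓ(2m)(y_T) ≤ bℓ(2m)(1)^θ · bℓ(2m)(y)^{1−θ}` with `bℓ(2m)(1) ≤ Cθ₀^{2m}` (§2, `1 < y_T`) and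
`bℓ(2m)(y_T) → Λℓ_T > 0` («WIDTH-ONE»/#586), so `bℓ(2m)(y)` cannot stay bounded along any subsequence.
[cite: BeatonBousquetMelouDeGierDuminilCopinGuttmann2014, Proposition 6 and Corollary 8 (arXiv v5 pp. 10–13: log-convexity; y_T the radius); lane «pcv-sawmu» a-p2 g22 — own result] -/
theorem tendsto_betaLenSum_atTop_of_stripYT_lt (hT : 1 ≤ T) (hyT : stripYT T < y) :
    Tendsto (fun m : ℕ => betaLenSum T (2 * m) y) atTop atTop := by
  have h1T := one_lt_stripYT hT
  have hy1 : 1 < y := h1T.trans hyT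
  have hy0 : 0 < y := by linarith
  -- the interpolation parameter
  have hlogy : 0 < Real.log y := Real.log_pos hy1
  have hlogT : 0 < Real.log (stripYT T) := Real.log_pos h1T
  have hlt : Real.log (stripYT T) < Real.log y := Real.log_lt_log (by linarith) hyT
  set θ : ℝ := 1 - Real.log (stripYT T) / Real.log y with hθ
  have hθ0 : 0 < θ := by rw [hθ, sub_pos, div_lt_one hlogy]; exact hlt
  have hθ1 : θ < 1 := by rw [hθ]; have := div_pos hlogT hlogy; linarith
  have hinterp : (1 : ℝ) ^ θ * y ^ (1 - θ) = stripYT T := by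
    rw [Real.one_rpow, one_mul, hθ, sub_sub_cancel, Real.rpow_def_of_pos hy0,
      show Real.log y * (Real.log (stripYT T) / Real.log y) = Real.log (stripYT T) by field_simp, Real.exp_log (by linarith)]
  -- the two ends
  obtain ⟨Λ, hΛ, hlim, -⟩ := exists_pos_tendsto_betaLenSum_even_of_one_le hT
  obtain ⟨C, θ₀, hθ₀0, hθ₀1, hC0, hb1⟩ := exists_betaLenSum_le_geometric hT one_pos h1T
  have hdecay : Tendsto (fun m : ℕ => (C * θ₀ ^ (2 * m)) ^ θ) atTop (𝓝 0) := by
    have h0 : Tendsto (fun m : ℕ => C * θ₀ ^ (2 * m)) atTop (𝓝 0) := by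
      have := (tendsto_pow_atTop_nhds_zero_of_lt_one hθ₀0.le hθ₀1).comp
        (tendsto_atTop_atTop.2 fun n => ⟨n, fun m hm => by omega⟩ : Tendsto (fun m : ℕ => 2 * m) atTop atTop)
      simpa using this.const_mul C
    have := h0.rpow_const (Or.inr hθ0.le)
    rwa [Real.zero_rpow hθ0.ne'] at this
  rw [tendsto_atTop]
  intro K
  have hK : 0 < max K 1 := lt_max_of_lt_right one_pos
  -- eventually `(Cθ₀^{2m})^θ · (max K 1)^{1−θ} < Λ/2 ≤ bℓ(2m)(y_T)`
  have hev1 : ∀ᶠ m : ℕ in atTop, (C * θ₀ ^ (2 * m)) ^ θ * (max K 1) ^ (1 - θ) < Λ / 2 := by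
    have h := hdecay.mul_const ((max K 1) ^ (1 - θ))
    rw [zero_mul] at h
    exact h.eventually (gt_mem_nhds (by positivity))
  have hev2 : ∀ᶠ m : ℕ in atTop, Λ / 2 ≤ betaLenSum T (2 * m) (stripYT T) :=
    hlim.eventually (eventually_ge_nhds (by linarith))
  filter_upwards [hev1, hev2] with m hm1 hm2
  by_contra hlt'
  push Not at hlt'
  have hbK : betaLenSum T (2 * m) y ≤ max K 1 := hlt'.le.trans (le_max_left _ _)
  have hHolder := betaLenSum_interp_le T (2 * m) one_pos hy0 hθ0.le hθ1.le
  rw [hinterp] at hHolder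
  have hb0 : 0 ≤ betaLenSum T (2 * m) y := (betaLenSum_noRenLen_nonneg hy0.le _).1
  have hA : betaLenSum T (2 * m) 1 ^ θ ≤ (C * θ₀ ^ (2 * m)) ^ θ :=
    Real.rpow_le_rpow (betaLenSum_noRenLen_nonneg zero_le_one _).1 (hb1 _) hθ0.le
  have hB : betaLenSum T (2 * m) y ^ (1 - θ) ≤ (max K 1) ^ (1 - θ) := Real.rpow_le_rpow hb0 hbK (by linarith)
  have := calc Λ / 2 ≤ betaLenSum T (2 * m) (stripYT T) := hm2
    _ ≤ betaLenSum T (2 * m) 1 ^ θ * betaLenSum T (2 * m) y ^ (1 - θ) := hHolder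
    _ ≤ (C * θ₀ ^ (2 * m)) ^ θ * (max K 1) ^ (1 - θ) :=
        mul_le_mul hA hB (Real.rpow_nonneg hb0 _) (Real.rpow_nonneg (by positivity) _)
  linarith

/-! ### §5 Below the threshold the length series sums to `B_T(x_c; y)` -/

/-- Lower bound: `Σ_{n<M} bℓ_T(n)(y) ≤ B_{T,L}(x_c; y)` for `M ≤ L + 1` (`y ≥ 0`, `T ≥ 1`). [cite: DuminilCopinSmirnov2012, §3; lane plumbing] -/
theorem sum_range_betaLenSum_le_stripGFy (hT : 1 ≤ T) (hy : 0 ≤ y) {M L : ℕ} (hML : M ≤ L + 1) :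
    ∑ n ∈ Finset.range M, betaLenSum T n y ≤ stripGFy T L (IsBetaDart T) y := by
  classical
  have hx := hexCriticalFugacity_pos_lt_one
  set S := (bridgeLists T L).filter (fun l => l.length < M) with hS
  have h1 : ∑ n ∈ Finset.range M, betaLenSum T n y = ∑ l ∈ S, hexCriticalFugacity ^ l.length * y ^ topCnt T l := by
    rw [← Finset.sum_fiberwise_of_maps_to (g := List.length) (t := Finset.range M) (s := S) (fun l hl => by
      rw [hS, mem_filter] at hl; exact mem_range.2 hl.2)]
    refine sum_congr rfl fun n hn => ?_
    rw [mem_range] at hn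
    rw [betaLenSum, ← betaLen_eq_of_le hT (show n ≤ L by omega) le_rfl, betaLen, hS, filter_filter]
    exact sum_congr (filter_congr fun l _ => ⟨fun h => ⟨by omega, h⟩, fun h => h.2⟩) fun _ _ => rfl
  rw [h1, stripGFy_beta_eq_sum_bridgeLists hT]
  exact sum_le_sum_of_subset_of_nonneg (filter_subset _ _) fun l _ _ =>
    mul_nonneg (pow_nonneg hx.1.le _) (pow_nonneg hy (topCnt T l))

/-- Upper bound: `B_{T,L}(x_c; y) ≤ Σ_{n ≤ |V(S_{T,L})|} bℓ_T(n)(y)` (`y ≥ 0`, `T ≥ 1`). [cite: DuminilCopinSmirnov2012, §3; lane plumbing] -/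
theorem stripGFy_le_sum_range_betaLenSum (hT : 1 ≤ T) (hy : 0 ≤ y) (L : ℕ) :
    stripGFy T L (IsBetaDart T) y ≤ ∑ n ∈ Finset.range ((stripV T L).card + 1), betaLenSum T n y := by
  classical
  have hx := hexCriticalFugacity_pos_lt_one
  have h1 : stripGFy T L (IsBetaDart T) y =
      ∑ n ∈ Finset.range ((stripV T L).card + 1), ∑ l ∈ betaLen T L n, hexCriticalFugacity ^ l.length * y ^ topCnt T l := by
    rw [stripGFy_beta_eq_sum_bridgeLists hT, ← Finset.sum_fiberwise_of_maps_to (g := List.length)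
      (t := Finset.range ((stripV T L).card + 1)) (fun l hl => by
        rw [mem_range]; have := length_le_card_stripV hT hl; omega)]
    simp only [betaLen, topCnt]
  rw [h1]
  refine sum_le_sum fun n _ => ?_
  rw [sum_betaLen_pow_eq, betaLenSum_eq_pow_mul_betaCount]
  exact mul_le_mul_of_nonneg_left (sum_betaLen_le_betaCount hT hy L n) (pow_nonneg hx.1.le _)

/-- ★★ **BELOW THE THRESHOLD THE LENGTH SERIES SUMS TO THE β-SERIES**: for `0 ≤ y < y_T` (`T ≥ 1`), `Σ_n bℓ_T(n)(y) = B_T(x_c; y) = HV.stripByLim T y`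
(`HasSum`) — the length decomposition of the tree's `B_T(x_c; ·)` below its radius (at `y_T` the terms tend to `Λℓ_T > 0`, above it they blow up).
[cite: BeatonBousquetMelouDeGierDuminilCopinGuttmann2014, §3.2 and Corollary 8 (arXiv v5 p. 12: y_T the radius of B_T(x_c; ·)); lane «pcv-sawmu» a-p2 g22 — own] -/
theorem hasSum_betaLenSum_of_lt_stripYT (hT : 1 ≤ T) (hy : 0 ≤ y) (hlt : y < stripYT T) :
    HasSum (fun n => betaLenSum T n y) (stripByLim T y) := by
  have hbdd := (mem_stripBddSet_of_lt_stripYT hT hy hlt).2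
  have hq0 : ∀ n, 0 ≤ betaLenSum T n y := fun n => (betaLenSum_noRenLen_nonneg hy n).1
  have hpart : ∀ M, ∑ n ∈ Finset.range M, betaLenSum T n y ≤ stripByLim T y := fun M =>
    (sum_range_betaLenSum_le_stripGFy hT hy (Nat.le_succ M)).trans (le_ciSup hbdd M)
  have hsum : Summable (fun n => betaLenSum T n y) := summable_of_sum_range_le hq0 hpart
  have hle : ∑' n, betaLenSum T n y ≤ stripByLim T y := Real.tsum_le_of_sum_range_le hq0 hpart
  have hge : stripByLim T y ≤ ∑' n, betaLenSum T n y :=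
    ciSup_le fun L => (stripGFy_le_sum_range_betaLenSum hT hy L).trans (hsum.sum_le_tsum _ fun n _ => hq0 n)
  rw [← le_antisymm hle hge]
  exact hsum.hasSum

end Literature.Probability.RandomPlanarGeometry.SAW.HV
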